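import Literature.Geometry.Kaehler.ComplexTorusTranscendentalLatticeMinimality
import Literature.Geometry.Kaehler.ComplexTorusRationalHodgeStructure
import HarnessLib

/-!
# The real structure of the transcendental Hodge structure and Huybrechts' weight-two definition: `T^l ⊗ ℂ` is stable under
# conjugation, `conj (T ⊗ ℂ)^{r,s} = (T ⊗ ℂ)^{s,r}`, the off-diagonal hypothesis of minimality may be HALVED (`r < s`), and in weight two
# `T² = (curve classes)^⊥ ∩ H²(X, ℤ)` is the least primitive sublattice `S ⊆ H²(X, ℤ)` with `H^{2,0}(X) ⊆ S ⊗ ℂ`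

Layer `Literature/Geometry/Kaehler`, namespace `Literature.Geometry.Kaehler.ComplexTorus`; lane `lit-hodgefound` (Track 2
foundations library), seat p09, generation 32, row g32-#7. THEOREMS ONLY (0 definitions); no named fact, net debt 0. Sequel of
`ComplexTorusTranscendentalLatticeMinimality` (g32-#5: the degree-`l` transcendental lattice `T = Hdg^{k,p}(X, ℤ)^⊥ ∩ Hˡ(X, ℤ)` of g31-#11
is the least primitive `S ⊆ Hˡ(X, ℤ)` with `⊕_{r ≠ s} H^{r,s}(X) ⊆ S ⊗ ℂ`) using the tree's real structure on `Hᵏ(X, ℂ) = Altᵏ_ℝ(E; ℂ)`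
(`conjForm`, `conj Λ^{r,s} = Λ^{s,r}` — `conjForm_mem_typeSubmodule_iff`; rational classes are real — `conjForm_eq_self_of_mem_rationalForms`).
Huybrechts (Ch. 3 Def. 2.5) asks only `V^{2,0} ⊂ T_ℂ`: for a sub-Hodge structure DEFINED OVER `ℚ` the complexification is stable under
complex conjugation, so `H^{r,s} ⊆ V ⊗ ℂ` forces `H^{s,r} = conj H^{r,s} ⊆ V ⊗ ℂ`; this file records that mechanism and the resulting sharper
minimality statements.

* §1 the `ℂ`-span of conjugation-fixed forms is conjugation-stable; hence `V ⊗ ℂ` (`V ⊆ Hˡ(X, ℚ)`) and `S ⊗ ℂ` (`S ⊆ Hˡ(X, ℤ)`) are.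
* §2 **`T ⊗ ℂ` is defined over `ℝ`**: `conj (T ⊗ ℂ) = T ⊗ ℂ` and **`conj ((T ⊗ ℂ) ∩ Λ^{r,s}) = (T ⊗ ℂ) ∩ Λ^{s,r}`** (Hodge symmetry of the
  transcendental Hodge structure).
* §3 **halving**: for `V ⊆ Hˡ(X, ℚ)`, `Λ^{r,s} ⊆ V ⊗ ℂ ⟹ Λ^{s,r} ⊆ V ⊗ ℂ`.
* §4 minimality with the halved hypothesis: **`T` is the least primitive `S ⊆ Hˡ(X, ℤ)` with `H^{r,s}(X) ⊆ S ⊗ ℂ` for all `r < s`, `r + s = l`**,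
  and `ℚ·T` the least such `ℚ`-subspace.
* §5 **weight two, any dimension `g`** (`k = 2g − 2`, `Hdg^{2g−2,g−1}(X, ℤ)` = the integral Hodge classes of curves): **`T² := Hdg^{2g−2,g−1}(X, ℤ)^⊥ ∩
  H²(X, ℤ)` is the least primitive sublattice `S ⊆ H²(X, ℤ)` with `H^{2,0}(X) ⊆ S ⊗ ℂ`** — Huybrechts' Definition 2.5 of the transcendental
  lattice, now a theorem about the orthogonal complement, for complex tori of every dimension; and `ℚ·T²` is the least `ℚ`-subspace
  `V ⊆ H²(X, ℚ)` with `H^{2,0}(X) ⊆ V ⊗ ℂ` (the rational transcendental Hodge structure).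

## Contents (theorems only)

* §1 `conjForm_mem_span_of_forall_conjForm_eq`, `conjForm_mem_span_complex_of_le_rationalForms`, `conjForm_mem_span_complex_of_le_integralForms`.
* §2 **`conjForm_mem_span_complex_integralHodgeAnnihilator`**, `conjForm_mem_span_complex_integralHodgeAnnihilator_iff`,
  **`conjForm_mem_span_complex_integralHodgeAnnihilator_inf_typeSubmodule_iff`**.
* §3 **`typeSubmodule_le_span_complex_of_le_rationalForms`**, `typeSubmodule_le_span_complex_of_le_integralForms`.
* §4 **`integralHodgeAnnihilator_le_of_nsmulSaturated_of_typeSubmodule_le_span_of_lt`**, `integralHodgeAnnihilator_subset_of_typeSubmodule_le_span_of_lt`,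
  **`isLeast_integralHodgeAnnihilator_of_lt`**, `isLeast_span_rat_integralHodgeAnnihilator_of_lt`.
* §5 **`isLeast_integralHodgeAnnihilator_two`** (Huybrechts Def. 2.5 ⟷ Lemma 3.1, weight two), **`isLeast_span_rat_integralHodgeAnnihilator_two`**.

## References

* [cite: Huybrechts2016K3, Ch. 3 Def. 2.5 (PDF p. 58: "the minimal primitive sub-Hodge structure `T ⊂ V` with `V^{2,0} = T^{2,0} ⊂ T_ℂ`"), Lemma 3.1 (PDF p. 62: `T(X) = NS(X)^⊥`), §1.1 (PDF p. 49)]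
* [cite: VoisinHodgeI2002, §2.3.1 (`conj Λ^{p,q} = Λ^{q,p}`); §7.1.1 (real structure of a Hodge structure, Hodge symmetry); §11.1.3 Prop. 11.20]
* [cite: Lange2023AbelianVarietiesComplex, §1.1.4 Prop. 1.1.20 (rational classes are real); §1.1.5 Thm. 1.1.21 (`H^{q,p} = conj H^{p,q}`); §7.2.2]
* [cite: ShiodaMitani1974, §1 (pp. 152–153: `T_X`)]
-/

noncomputable section

open Module Function
open Literature.Analysis.Complex (IsOfTypeAt typeSubmodule)
open Literature.LinearAlgebra.Alternating (conjForm conj_conj conj_add conj_smul conj_zero)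

namespace Literature.Geometry.Kaehler.ComplexTorus

section RealStructure

variable {ι : Type*} [Fintype ι] [DecidableEq ι] {E : Type*} [NormedAddCommGroup E] [NormedSpace ℂ E]
  (Φ : (ι → ℝ) ≃L[ℝ] E) {n k l : ℕ} (e : Fin n ≃ ι) (h : k + l = n)

/-! ## §1 Complexifications of rational subspaces are conjugation-stable -/

omit [Fintype ι] [DecidableEq ι] in
/-- The `ℂ`-span of conjugation-fixed forms is stable under conjugation. [cite: VoisinHodgeI2002, §7.1.1] -/
theorem conjForm_mem_span_of_forall_conjForm_eq {m : ℕ} {G : Set (E [⋀^Fin m]→L[ℝ] ℂ)} (hG : ∀ g ∈ G, conjForm g = g)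
    {v : E [⋀^Fin m]→L[ℝ] ℂ} (hv : v ∈ Submodule.span ℂ G) : conjForm v ∈ Submodule.span ℂ G := by
  induction hv using Submodule.span_induction with
  | mem g hg => rw [hG g hg]; exact Submodule.subset_span hg
  | zero => rw [conj_zero]; exact Submodule.zero_mem _
  | add x y _ _ hx hy => rw [conj_add]; exact Submodule.add_mem _ hx hy
  | smul c x _ hx => rw [conj_smul]; exact Submodule.smul_mem _ _ hx

omit [DecidableEq ι] in
/-- **`V ⊗ ℂ` is conjugation-stable for `V ⊆ Hˡ(X, ℚ)`** (rational classes are real). [cite: Lange2023AbelianVarietiesComplex, §1.1.4 Prop. 1.1.20] [cite: VoisinHodgeI2002, §7.1.1] -/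
theorem conjForm_mem_span_complex_of_le_rationalForms {V : Submodule ℚ (E [⋀^Fin l]→L[ℝ] ℂ)} (hVQ : V ≤ rationalForms Φ l)
    {v : E [⋀^Fin l]→L[ℝ] ℂ} (hv : v ∈ Submodule.span ℂ (V : Set (E [⋀^Fin l]→L[ℝ] ℂ))) :
    conjForm v ∈ Submodule.span ℂ (V : Set (E [⋀^Fin l]→L[ℝ] ℂ)) :=
  conjForm_mem_span_of_forall_conjForm_eq (fun _ hg ↦ conjForm_eq_self_of_mem_rationalForms Φ (hVQ hg)) hv

omit [DecidableEq ι] in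
/-- **`S ⊗ ℂ` is conjugation-stable for `S ⊆ Hˡ(X, ℤ)`.** [cite: Lange2023AbelianVarietiesComplex, §1.1.4 Prop. 1.1.20] [cite: VoisinHodgeI2002, §7.1.1] -/
theorem conjForm_mem_span_complex_of_le_integralForms {S : AddSubgroup (E [⋀^Fin l]→L[ℝ] ℂ)} (hSZ : S ≤ integralForms Φ l)
    {v : E [⋀^Fin l]→L[ℝ] ℂ} (hv : v ∈ Submodule.span ℂ (S : Set (E [⋀^Fin l]→L[ℝ] ℂ))) :
    conjForm v ∈ Submodule.span ℂ (S : Set (E [⋀^Fin l]→L[ℝ] ℂ)) :=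
  conjForm_mem_span_of_forall_conjForm_eq
    (fun _ hg ↦ conjForm_eq_self_of_mem_rationalForms Φ (mem_rationalForms_of_mem_integralForms Φ (hSZ hg))) hv

/-! ## §2 `T ⊗ ℂ` is defined over `ℝ`; Hodge symmetry of its pieces -/

/-- **`conj (T ⊗ ℂ) ⊆ T ⊗ ℂ`**: the complexified transcendental lattice is stable under complex conjugation (it is spanned by integral,
hence real, classes). [cite: VoisinHodgeI2002, §7.1.1] [cite: Huybrechts2016K3, §1.1 (PDF p. 49) and Ch. 3 §2.2] -/
theorem conjForm_mem_span_complex_integralHodgeAnnihilator (p : ℕ) {v : E [⋀^Fin l]→L[ℝ] ℂ}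
    (hv : v ∈ Submodule.span ℂ ((integralForms Φ l ⊓ ⨅ s : integralHodgeClassesIn Φ k p,
        (LinearMap.ker (poincarePairing Φ e h (s : E [⋀^Fin k]→L[ℝ] ℂ))).toAddSubgroup :
          AddSubgroup (E [⋀^Fin l]→L[ℝ] ℂ)) : Set (E [⋀^Fin l]→L[ℝ] ℂ))) :
    conjForm v ∈ Submodule.span ℂ ((integralForms Φ l ⊓ ⨅ s : integralHodgeClassesIn Φ k p,
        (LinearMap.ker (poincarePairing Φ e h (s : E [⋀^Fin k]→L[ℝ] ℂ))).toAddSubgroup :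
          AddSubgroup (E [⋀^Fin l]→L[ℝ] ℂ)) : Set (E [⋀^Fin l]→L[ℝ] ℂ)) :=
  conjForm_mem_span_complex_of_le_integralForms Φ inf_le_left hv

/-- `conj v ∈ T ⊗ ℂ ⟺ v ∈ T ⊗ ℂ`. [cite: VoisinHodgeI2002, §7.1.1] -/
theorem conjForm_mem_span_complex_integralHodgeAnnihilator_iff (p : ℕ) {v : E [⋀^Fin l]→L[ℝ] ℂ} :
    conjForm v ∈ Submodule.span ℂ ((integralForms Φ l ⊓ ⨅ s : integralHodgeClassesIn Φ k p,
        (LinearMap.ker (poincarePairing Φ e h (s : E [⋀^Fin k]→L[ℝ] ℂ))).toAddSubgroup :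
          AddSubgroup (E [⋀^Fin l]→L[ℝ] ℂ)) : Set (E [⋀^Fin l]→L[ℝ] ℂ)) ↔
      v ∈ Submodule.span ℂ ((integralForms Φ l ⊓ ⨅ s : integralHodgeClassesIn Φ k p,
        (LinearMap.ker (poincarePairing Φ e h (s : E [⋀^Fin k]→L[ℝ] ℂ))).toAddSubgroup :
          AddSubgroup (E [⋀^Fin l]→L[ℝ] ℂ)) : Set (E [⋀^Fin l]→L[ℝ] ℂ)) :=
  ⟨fun hv ↦ by simpa only [conj_conj] using conjForm_mem_span_complex_integralHodgeAnnihilator Φ e h p hv,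
    conjForm_mem_span_complex_integralHodgeAnnihilator Φ e h p⟩

/-- **Hodge symmetry of the transcendental Hodge structure: `conj ((T ⊗ ℂ) ∩ Λ^{r,s}) = (T ⊗ ℂ) ∩ Λ^{s,r}`** — `conj v ∈ (T ⊗ ℂ)^{r,s}` iff
`v ∈ (T ⊗ ℂ)^{s,r}` (`r + s = l`). [cite: VoisinHodgeI2002, §2.3.1 and §7.1.1] [cite: Lange2023AbelianVarietiesComplex, §1.1.5 Thm. 1.1.21] -/
theorem conjForm_mem_span_complex_integralHodgeAnnihilator_inf_typeSubmodule_iff (p : ℕ) {r s : ℕ} (hrs : r + s = l)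
    {v : E [⋀^Fin l]→L[ℝ] ℂ} :
    conjForm v ∈ Submodule.span ℂ ((integralForms Φ l ⊓ ⨅ s : integralHodgeClassesIn Φ k p,
        (LinearMap.ker (poincarePairing Φ e h (s : E [⋀^Fin k]→L[ℝ] ℂ))).toAddSubgroup :
          AddSubgroup (E [⋀^Fin l]→L[ℝ] ℂ)) : Set (E [⋀^Fin l]→L[ℝ] ℂ)) ⊓ typeSubmodule E l r s ↔
      v ∈ Submodule.span ℂ ((integralForms Φ l ⊓ ⨅ s : integralHodgeClassesIn Φ k p,
        (LinearMap.ker (poincarePairing Φ e h (s : E [⋀^Fin k]→L[ℝ] ℂ))).toAddSubgroup :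
          AddSubgroup (E [⋀^Fin l]→L[ℝ] ℂ)) : Set (E [⋀^Fin l]→L[ℝ] ℂ)) ⊓ typeSubmodule E l s r := by
  rw [Submodule.mem_inf, Submodule.mem_inf, conjForm_mem_span_complex_integralHodgeAnnihilator_iff Φ e h p,
    conjForm_mem_typeSubmodule_iff hrs]

/-! ## §3 Halving the off-diagonal hypothesis -/

omit [DecidableEq ι] in
/-- **`Λ^{r,s} ⊆ V ⊗ ℂ ⟹ Λ^{s,r} ⊆ V ⊗ ℂ` for a rational subspace `V ⊆ Hˡ(X, ℚ)`** (`r + s = l`; conjugate: `Λ^{s,r} = conj Λ^{r,s}` and `V ⊗ ℂ` is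
conjugation-stable). [cite: VoisinHodgeI2002, §2.3.1 and §7.1.1] [cite: Lange2023AbelianVarietiesComplex, §1.1.5 Thm. 1.1.21] -/
theorem typeSubmodule_le_span_complex_of_le_rationalForms {V : Submodule ℚ (E [⋀^Fin l]→L[ℝ] ℂ)} (hVQ : V ≤ rationalForms Φ l)
    {r s : ℕ} (hrs : r + s = l) (hV : typeSubmodule E l r s ≤ Submodule.span ℂ (V : Set (E [⋀^Fin l]→L[ℝ] ℂ))) :
    typeSubmodule E l s r ≤ Submodule.span ℂ (V : Set (E [⋀^Fin l]→L[ℝ] ℂ)) := fun β hβ ↦ by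
  have h1 : conjForm β ∈ typeSubmodule E l r s := (conjForm_mem_typeSubmodule_iff hrs).2 hβ
  have h2 := conjForm_mem_span_complex_of_le_rationalForms Φ hVQ (hV h1)
  rwa [conj_conj] at h2

omit [DecidableEq ι] in
/-- The same for `S ⊗ ℂ`, `S ⊆ Hˡ(X, ℤ)`. [cite: VoisinHodgeI2002, §2.3.1 and §7.1.1] -/
theorem typeSubmodule_le_span_complex_of_le_integralForms {S : AddSubgroup (E [⋀^Fin l]→L[ℝ] ℂ)} (hSZ : S ≤ integralForms Φ l)
    {r s : ℕ} (hrs : r + s = l) (hS : typeSubmodule E l r s ≤ Submodule.span ℂ (S : Set (E [⋀^Fin l]→L[ℝ] ℂ))) :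
    typeSubmodule E l s r ≤ Submodule.span ℂ (S : Set (E [⋀^Fin l]→L[ℝ] ℂ)) := fun β hβ ↦ by
  have h1 : conjForm β ∈ typeSubmodule E l r s := (conjForm_mem_typeSubmodule_iff hrs).2 hβ
  have h2 := conjForm_mem_span_complex_of_le_integralForms Φ hSZ (hS h1)
  rwa [conj_conj] at h2

/-! ## §4 Minimality with the halved hypothesis `r < s` -/

/-- **`ℤ`-minimality, halved**: a primitive `S ⊆ Hˡ(X, ℤ)` with `H^{r,s}(X) ⊆ S ⊗ ℂ` for all `r < s`, `r + s = l`, contains `T` (`2p = k`,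
`k + l = 2g`). [cite: Huybrechts2016K3, Ch. 3 Def. 2.5 (PDF p. 58) and Lemma 3.1 (PDF p. 62)] [cite: VoisinHodgeI2002, §7.1.1] -/
theorem integralHodgeAnnihilator_le_of_nsmulSaturated_of_typeSubmodule_le_span_of_lt [FiniteDimensional ℂ E] {p : ℕ} (hk : p + p = k)
    {S : AddSubgroup (E [⋀^Fin l]→L[ℝ] ℂ)} (hSZ : S ≤ integralForms Φ l)
    (hsat : (S.addSubgroupOf (integralForms Φ l)).toAddSubmonoid.NSMulSaturated)
    (hS : ∀ r s : ℕ, r + s = l → r < s → typeSubmodule E l r s ≤ Submodule.span ℂ (S : Set (E [⋀^Fin l]→L[ℝ] ℂ))) :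
    integralForms Φ l ⊓ ⨅ s : integralHodgeClassesIn Φ k p,
        (LinearMap.ker (poincarePairing Φ e h (s : E [⋀^Fin k]→L[ℝ] ℂ))).toAddSubgroup ≤ S :=
  integralHodgeAnnihilator_le_of_nsmulSaturated_of_typeSubmodule_le_span Φ e h hk hSZ hsat fun r s hrs hne ↦ by
    rcases lt_or_gt_of_ne hne with hlt | hgt
    · exact hS r s hrs hlt
    · exact typeSubmodule_le_span_complex_of_le_integralForms Φ hSZ (by omega) (hS s r (by omega) hgt)

/-- **`ℚ`-minimality, halved**: a `ℚ`-subspace `V ⊆ Hˡ(X, ℚ)` with `H^{r,s}(X) ⊆ V ⊗ ℂ` for all `r < s` contains `T`.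
[cite: Huybrechts2016K3, Ch. 3 Def. 2.5 (PDF p. 58) and Lemma 3.1 (PDF p. 62)] [cite: VoisinHodgeI2002, §7.1.1] -/
theorem integralHodgeAnnihilator_subset_of_typeSubmodule_le_span_of_lt [FiniteDimensional ℂ E] {p : ℕ} (hk : p + p = k)
    {V : Submodule ℚ (E [⋀^Fin l]→L[ℝ] ℂ)} (hVQ : V ≤ rationalForms Φ l)
    (hV : ∀ r s : ℕ, r + s = l → r < s → typeSubmodule E l r s ≤ Submodule.span ℂ (V : Set (E [⋀^Fin l]→L[ℝ] ℂ))) :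
    ((integralForms Φ l ⊓ ⨅ s : integralHodgeClassesIn Φ k p,
        (LinearMap.ker (poincarePairing Φ e h (s : E [⋀^Fin k]→L[ℝ] ℂ))).toAddSubgroup : AddSubgroup (E [⋀^Fin l]→L[ℝ] ℂ)) :
          Set (E [⋀^Fin l]→L[ℝ] ℂ)) ⊆ V :=
  integralHodgeAnnihilator_subset_of_typeSubmodule_le_span Φ e h hk hVQ fun r s hrs hne ↦ by
    rcases lt_or_gt_of_ne hne with hlt | hgt
    · exact hV r s hrs hlt
    · exact typeSubmodule_le_span_complex_of_le_rationalForms Φ hVQ (by omega) (hV s r (by omega) hgt)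

/-- **`T` is the least primitive `S ⊆ Hˡ(X, ℤ)` with `H^{r,s}(X) ⊆ S ⊗ ℂ` for all `r < s`, `r + s = l`.**
[cite: Huybrechts2016K3, Ch. 3 Def. 2.5 (PDF p. 58) and Lemma 3.1 (PDF p. 62)] [cite: ShiodaMitani1974, §1 (pp. 152–153)] -/
theorem isLeast_integralHodgeAnnihilator_of_lt [FiniteDimensional ℂ E] {p : ℕ} (hk : p + p = k) :
    IsLeast {S : AddSubgroup (E [⋀^Fin l]→L[ℝ] ℂ) | S ≤ integralForms Φ l ∧ (S.addSubgroupOf (integralForms Φ l)).toAddSubmonoid.NSMulSaturated ∧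
        ∀ r s : ℕ, r + s = l → r < s → typeSubmodule E l r s ≤ Submodule.span ℂ (S : Set (E [⋀^Fin l]→L[ℝ] ℂ))}
      (integralForms Φ l ⊓ ⨅ s : integralHodgeClassesIn Φ k p,
        (LinearMap.ker (poincarePairing Φ e h (s : E [⋀^Fin k]→L[ℝ] ℂ))).toAddSubgroup) := by
  refine ⟨⟨inf_le_left, nsmulSaturated_integralHodgeAnnihilator_addSubgroupOf Φ e h p, fun r s _ hrs ↦ ?_⟩, fun S hS ↦ ?_⟩
  · exact typeSubmodule_le_span_complex_integralHodgeAnnihilator Φ e h p hrs.ne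
  · exact integralHodgeAnnihilator_le_of_nsmulSaturated_of_typeSubmodule_le_span_of_lt Φ e h hk hS.1 hS.2.1 hS.2.2

/-- **`ℚ·T` is the least `ℚ`-subspace `V ⊆ Hˡ(X, ℚ)` with `H^{r,s}(X) ⊆ V ⊗ ℂ` for all `r < s`, `r + s = l`.**
[cite: Huybrechts2016K3, Ch. 3 Def. 2.5 (PDF p. 58) and Lemma 3.1 (PDF p. 62)] -/
theorem isLeast_span_rat_integralHodgeAnnihilator_of_lt [FiniteDimensional ℂ E] {p : ℕ} (hk : p + p = k) :
    IsLeast {V : Submodule ℚ (E [⋀^Fin l]→L[ℝ] ℂ) | V ≤ rationalForms Φ l ∧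
        ∀ r s : ℕ, r + s = l → r < s → typeSubmodule E l r s ≤ Submodule.span ℂ (V : Set (E [⋀^Fin l]→L[ℝ] ℂ))}
      (Submodule.span ℚ ((integralForms Φ l ⊓ ⨅ s : integralHodgeClassesIn Φ k p,
        (LinearMap.ker (poincarePairing Φ e h (s : E [⋀^Fin k]→L[ℝ] ℂ))).toAddSubgroup : AddSubgroup (E [⋀^Fin l]→L[ℝ] ℂ)) :
          Set (E [⋀^Fin l]→L[ℝ] ℂ))) := by
  obtain ⟨⟨hQ, hoff⟩, -⟩ := isLeast_span_rat_integralHodgeAnnihilator Φ e h hk (l := l)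
  refine ⟨⟨hQ, fun r s hrs hlt ↦ hoff r s hrs hlt.ne⟩, fun V hV ↦ ?_⟩
  exact Submodule.span_le.2 (integralHodgeAnnihilator_subset_of_typeSubmodule_le_span_of_lt Φ e h hk hV.1 hV.2)

end RealStructure

/-! ## §5 Weight two: Huybrechts' definition of the transcendental lattice, for complex tori of every dimension -/

section WeightTwo

variable {ι : Type*} [Fintype ι] [DecidableEq ι] {E : Type*} [NormedAddCommGroup E] [NormedSpace ℂ E]
  (Φ : (ι → ℝ) ≃L[ℝ] E) {n k : ℕ} (e : Fin n ≃ ι) (h : k + 2 = n)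

/-- **Huybrechts' Definition 2.5 as a theorem, weight two, any dimension**: the lattice `T² := Hdg^{2g−2,g−1}(X, ℤ)^⊥ ∩ H²(X, ℤ)` (the classes of
`H²(X, ℤ)` cup-orthogonal to every integral Hodge class of curves; `k = 2g − 2 = 2p`) is the LEAST primitive sublattice `S ⊆ H²(X, ℤ)` with
`H^{2,0}(X) ⊆ S ⊗ ℂ` — "the minimal primitive sub-Hodge structure `T ⊂ V` with `V^{2,0} = T^{2,0} ⊂ T_ℂ`" coincides with the orthogonal complement
(Lemma 3.1 "`T(X) = NS(X)^⊥`" for surfaces). (`H^{2,0} ⊆ S ⊗ ℂ` gives `H^{0,2} = conj H^{2,0} ⊆ S ⊗ ℂ`, §3, and these are all the off-diagonal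
summands of `H²`.) [cite: Huybrechts2016K3, Ch. 3 Def. 2.5 (PDF p. 58) and Lemma 3.1 (PDF p. 62)] [cite: ShiodaMitani1974, §1 (pp. 152–153)] -/
theorem isLeast_integralHodgeAnnihilator_two [FiniteDimensional ℂ E] {p : ℕ} (hk : p + p = k) :
    IsLeast {S : AddSubgroup (E [⋀^Fin 2]→L[ℝ] ℂ) | S ≤ integralForms Φ 2 ∧ (S.addSubgroupOf (integralForms Φ 2)).toAddSubmonoid.NSMulSaturated ∧
        typeSubmodule E 2 2 0 ≤ Submodule.span ℂ (S : Set (E [⋀^Fin 2]→L[ℝ] ℂ))}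
      (integralForms Φ 2 ⊓ ⨅ s : integralHodgeClassesIn Φ k p,
        (LinearMap.ker (poincarePairing Φ e h (s : E [⋀^Fin k]→L[ℝ] ℂ))).toAddSubgroup) := by
  refine ⟨⟨inf_le_left, nsmulSaturated_integralHodgeAnnihilator_addSubgroupOf Φ e h p, ?_⟩, fun S hS ↦ ?_⟩
  · exact typeSubmodule_le_span_complex_integralHodgeAnnihilator Φ e h p (by norm_num : (2 : ℕ) ≠ 0)
  · refine integralHodgeAnnihilator_le_of_nsmulSaturated_of_typeSubmodule_le_span_of_lt Φ e h hk hS.1 hS.2.1 fun r s hrs hlt ↦ ?_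
    have hr : r = 0 := by omega
    have hs : s = 2 := by omega
    subst hr hs
    exact typeSubmodule_le_span_complex_of_le_integralForms Φ hS.1 (by norm_num) hS.2.2

/-- **The rational transcendental Hodge structure of weight two**: `ℚ·T²` is the least `ℚ`-subspace `V ⊆ H²(X, ℚ)` with `H^{2,0}(X) ⊆ V ⊗ ℂ`.
[cite: Huybrechts2016K3, Ch. 3 Def. 2.5 (PDF p. 58), Lemma 3.1 (PDF p. 62) and §2.2–2.3] -/
theorem isLeast_span_rat_integralHodgeAnnihilator_two [FiniteDimensional ℂ E] {p : ℕ} (hk : p + p = k) :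
    IsLeast {V : Submodule ℚ (E [⋀^Fin 2]→L[ℝ] ℂ) | V ≤ rationalForms Φ 2 ∧
        typeSubmodule E 2 2 0 ≤ Submodule.span ℂ (V : Set (E [⋀^Fin 2]→L[ℝ] ℂ))}
      (Submodule.span ℚ ((integralForms Φ 2 ⊓ ⨅ s : integralHodgeClassesIn Φ k p,
        (LinearMap.ker (poincarePairing Φ e h (s : E [⋀^Fin k]→L[ℝ] ℂ))).toAddSubgroup : AddSubgroup (E [⋀^Fin 2]→L[ℝ] ℂ)) :
          Set (E [⋀^Fin 2]→L[ℝ] ℂ))) := by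
  obtain ⟨⟨hQ, hoff⟩, -⟩ := isLeast_span_rat_integralHodgeAnnihilator Φ e h hk (l := 2)
  refine ⟨⟨hQ, hoff 2 0 rfl (by norm_num)⟩, fun V hV ↦ Submodule.span_le.2 ?_⟩
  refine integralHodgeAnnihilator_subset_of_typeSubmodule_le_span_of_lt Φ e h hk hV.1 fun r s hrs hlt ↦ ?_
  have hr : r = 0 := by omega
  have hs : s = 2 := by omega
  subst hr hs
  exact typeSubmodule_le_span_complex_of_le_rationalForms Φ hV.1 (by norm_num) hV.2

end WeightTwo

end Literature.Geometry.Kaehler.ComplexTorus
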